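import Literature.NumberTheory.Rogawski1990.ArchSingularCurveNormPair          -- ★ B-p12 p839172: the lifted curve `(γH, γG)`, `isArchNormPair_archSingularCurve`
import Literature.NumberTheory.Automorphic.ArchStableClassTorus                 -- ★ (V8): `exists_isConj_archDiagTorus_of_isStablyConj_of_conj`
import Literature.NumberTheory.Automorphic.ArchStableOrbitalSumRepresentatives  -- ★ `isCompact_centralizer_archDiagTorus`
import HarnessLib

/-!
# Along B-p12's lifted curve: `γ_H(ψ)` is `G`-regular when its three angles are distinct, and every norm partner has a COMPACT centraliser
(R3 STEP 3 node (3R), `G′`-side; the `hreg` ∕ `hZ′` binders of ★ `ArchDeltaTransferHaarForm` at torus points; Rogawski 1990 §3.1, §14.3, §14.5 p. 238)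

Topic `NumberTheory/Rogawski1990`; namespace `Literature.NumberTheory.Rogawski1990`.  THEOREMS ONLY (no `def`, no instance, no notation, no axiom, no named fact, no `sorry`).
Cell `pub/hodgecm-mathlib`, ENGINE T1 (crux H413 = `stmt-HodgeConjecture-24833`); ROAD-Sd residual R3 «(S-c) central vanishing» (`stub_ScCore`), STEP 3 node (3R) of the integration census
`CENSUS-R3-STEP3-Integration` b54b3c40 (pen of record F0P3a-p03 (g10), LEAD WORDS T8-76 (C) ∕ T8-79 (1)).

WHY.  ★ (E1) `finsum_integral_comp_conj_eq_finsum_delta_mul_integral_comp_conj_of_isArchDeltaTransfer` ((vi) in Haar currency) is read at a `G`-REGULAR `γ_H ∈ H_∞` whose norm partners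
`γ′ ∈ G′_∞` have COMPACT centralisers (binders `hreg`, `hZ′`).  The assembly 3Z reads it along B-p12's lifted curve ★ `ArchSingularCurveNormPair` (frame `(L, α, z₀, c, γH, γG, hγH, hγG)`
VERBATIM), on the diagonal `G′`-frame `U(diag α)(L ⊗ ℝ)`; this file discharges the two binders there:
* §1 **`isArchGRegular_archSingularCurve`**: if at every place the three angles `z₀ w i · e^{i s_i c_w ψ}` are pairwise distinct, `γ_H(ψ)` is `G`-regular — its norm partner `γG(ψ)` is the torus
  point `t(z(ψ))` (★ `isArchNormPair_archSingularCurve`), regular iff the angles are distinct (★ `isRegularElt_archDiagTorus_iff`), and regularity passes along `IsConj` (★ `isRegularElt_of_isConj`).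
* §2 **`isCompact_centralizer_of_isArchNormPair_archSingularCurve`** ∕ **`compactSpace_…`**: every norm partner `γ′` of `γ_H(ψ)` is stably conjugate to `t(z(ψ))`, hence CONJUGATE in `G′_∞` to a
  relabelled torus point `t(z(ψ) ∘ ρ)` (★ (V8) `exists_isConj_archDiagTorus_of_isStablyConj_of_conj`), whose centraliser is the compact torus (★ `isCompact_centralizer_archDiagTorus`); centralisers of
  conjugate elements are conjugate (`coe_centralizer_singleton_conj_eq_image`).
HONEST LABEL: HC_CM is proved only modulo the 7 printed citations until rung 0 closes; this file is bookkeeping over ★ (V8) and B-p12's curve and pays nothing by itself.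

## References
* [Rogawski1990] J. D. Rogawski, *Automorphic Representations of Unitary Groups in Three Variables*, Ann. of Math. Stud. 123 (1990), §3.1 p. 19 (regular elements, stable classes of torus
  points), §14.3 p. 234 (`G`-regular `γ_H`, norm pairs), §14.5 Lemma 14.5.2 (c) p. 238.
* [BrockerTomDieck1985] T. Bröcker, T. tom Dieck, *Representations of Compact Lie Groups* (1985), Ch. IV (3.1)–(3.2) (maximal tori, Weyl relabelling).
-/

set_option autoImplicit false

noncomputable section

open NumberField NumberField.InfinitePlace Matrix Topology
open Literature.NumberTheory.Automorphic Literature.NumberTheory.Automorphic.UnitaryGroup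
open scoped MatrixGroups

namespace Literature.NumberTheory.Rogawski1990

/-! ## §0 Centralisers of conjugate elements (generic) -/

section Generic

variable {G : Type*} [Group G]

/-- `Z(q t q⁻¹) = q Z(t) q⁻¹` as sets. [folklore] [cite: BrockerTomDieck1985, Ch. IV (3.1)] -/
theorem coe_centralizer_singleton_conj_eq_image (q t : G) :
    ((Subgroup.centralizer ({q * t * q⁻¹} : Set G)) : Set G) = (fun x => q * x * q⁻¹) '' (Subgroup.centralizer ({t} : Set G) : Set G) := by
  ext x
  simp only [SetLike.mem_coe, Set.mem_image, Subgroup.mem_centralizer_singleton_iff]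
  constructor
  · intro hx
    refine ⟨q⁻¹ * x * q, ?_, by group⟩
    calc q⁻¹ * x * q * t = q⁻¹ * (x * (q * t * q⁻¹)) * q := by group
      _ = q⁻¹ * (q * t * q⁻¹ * x) * q := by rw [hx]
      _ = t * (q⁻¹ * x * q) := by group
  · rintro ⟨y, hy, rfl⟩
    calc q * y * q⁻¹ * (q * t * q⁻¹) = q * (y * t) * q⁻¹ := by group
      _ = q * (t * y) * q⁻¹ := by rw [hy]
      _ = q * t * q⁻¹ * (q * y * q⁻¹) := by group

variable [TopologicalSpace G] [IsTopologicalGroup G]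

/-- The centraliser of a conjugate of `t` is compact when the centraliser of `t` is. [folklore] [cite: BrockerTomDieck1985, Ch. IV (3.1)] -/
theorem isCompact_centralizer_singleton_of_isConj {t δ : G} (h : IsConj t δ) (ht : IsCompact ((Subgroup.centralizer ({t} : Set G)) : Set G)) :
    IsCompact ((Subgroup.centralizer ({δ} : Set G)) : Set G) := by
  obtain ⟨c, hc⟩ := isConj_iff.1 h
  rw [← hc, coe_centralizer_singleton_conj_eq_image]
  exact ht.image (by fun_prop)

end Generic

/-! ## §1–§2 Along B-p12's lifted curve on the diagonal `G′`-frame -/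

section Curve

variable (L : Type) [Field L] [NumberField L] [IsCMField L] (α : Fin 3 → L)
  (z₀ : {w : InfinitePlace L // IsComplex w} → Fin 3 → Circle) (c : {w : InfinitePlace L // IsComplex w} → ℝ)
  (γH : ℝ →
    ↥(UnitaryGroup.arch (↥(maximalRealSubfield L)) L (IsCMField.complexConj L) 2
        (Matrix.of fun i j : Fin 2 => if i.val + j.val + 1 = 2 then (1 : L) else 0)) ×
      ↥(UnitaryGroup.arch (↥(maximalRealSubfield L)) L (IsCMField.complexConj L) 1
        (Matrix.of fun i j : Fin 1 => if i.val + j.val + 1 = 1 then (1 : L) else 0)))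
  (γG : ℝ → ↥(UnitaryGroup.arch (↥(maximalRealSubfield L)) L (IsCMField.complexConj L) 3 (Matrix.diagonal α)))
  (hγH : γH = fun ψ =>
    ((UnitaryGroup.archPiEquivCM 2 L (Matrix.of fun i j : Fin 2 => if i.val + j.val + 1 = 2 then (1 : L) else 0)).symm fun w =>
        ⟨Matrix.GeneralLinearGroup.mkOfDetNeZero !![(1 : ℂ), 1; 1, -1] UnitaryGroup.det_cayleyTwo_ne_zero *
            UnitaryGroup.circleDiagonal 2 ![z₀ w 0 * Circle.exp (![(1 : ℝ), 0, -1] 0 * (c w * ψ)), z₀ w 2 * Circle.exp (![(1 : ℝ), 0, -1] 2 * (c w * ψ))] *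
          (Matrix.GeneralLinearGroup.mkOfDetNeZero !![(1 : ℂ), 1; 1, -1] UnitaryGroup.det_cayleyTwo_ne_zero)⁻¹,
          UnitaryGroup.cayley_conj_circleDiagonal_mem_archLocal L w _⟩,
      (UnitaryGroup.archPiEquivCM 1 L (Matrix.of fun i j : Fin 1 => if i.val + j.val + 1 = 1 then (1 : L) else 0)).symm fun w =>
        ⟨UnitaryGroup.circleDiagonal 1 ![z₀ w 1 * Circle.exp (![(1 : ℝ), 0, -1] 1 * (c w * ψ))],
          UnitaryGroup.circleDiagonal_mem_archLocal_antidiagOne L w _⟩))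
  (hγG : γG = fun ψ => UnitaryGroup.archDiagTorus L 3 α fun w i => z₀ w i * Circle.exp (![(1 : ℝ), 0, -1] i * (c w * ψ)))

include hγG in
/-- The `G′`-side curve point is REGULAR iff its three angles are pairwise distinct at every place (★ `isRegularElt_archDiagTorus_iff`). [cite: Rogawski1990, §3.1 p. 19] -/
theorem isRegularElt_archSingularCurveG_iff (ψ : ℝ) :
    IsRegularElt ((γG ψ).val : GL (Fin 3) (mixedEmbedding.mixedSpace L)) ↔
      ∀ w : {w : InfinitePlace L // IsComplex w}, Function.Injective (fun i : Fin 3 => z₀ w i * Circle.exp (![(1 : ℝ), 0, -1] i * (c w * ψ))) := by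
  rw [hγG]
  exact isRegularElt_archDiagTorus_iff L 3 α _

include hγH hγG in
/-- **`γ_H(ψ)` IS `G`-REGULAR when its three angles are distinct at every place**: its norm partner `γG(ψ) = t(z(ψ))` (★ `isArchNormPair_archSingularCurve`) is then regular, and regularity
passes along `ι_∞(γ_H(ψ)) ↔ γG(ψ)` (★ `isRegularElt_of_isConj`). [cite: Rogawski1990, §3.1 p. 19; §14.3 p. 234] -/
theorem isArchGRegular_archSingularCurve (ψ : ℝ)
    (hinj : ∀ w : {w : InfinitePlace L // IsComplex w}, Function.Injective (fun i : Fin 3 => z₀ w i * Circle.exp (![(1 : ℝ), 0, -1] i * (c w * ψ)))) :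
    IsArchGRegular L (γH ψ) := by
  have hnp := isArchNormPair_archSingularCurve L α z₀ c γH γG hγH hγG ψ
  rw [isArchNormPair_iff] at hnp
  have hreg : IsRegularElt ((γG ψ).val : GL (Fin 3) (mixedEmbedding.mixedSpace L)) := (isRegularElt_archSingularCurveG_iff L α z₀ c γG hγG ψ).2 hinj
  exact isRegularElt_of_isConj hnp.symm hreg

include hγH hγG in
/-- **EVERY NORM PARTNER OF `γ_H(ψ)` HAS A COMPACT CENTRALISER** (angles distinct, `α_i ≠ 0` real): a norm partner `γ′ ∈ U(diag α)(L ⊗ ℝ)` is stably conjugate to the torus point `t(z(ψ))`, hence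
conjugate in `G′_∞` to a relabelled torus point (★ (V8) `exists_isConj_archDiagTorus_of_isStablyConj_of_conj`), whose centraliser is the compact torus (★ `isCompact_centralizer_archDiagTorus`).
[cite: Rogawski1990, §3.1 p. 19; §14.3 p. 234] [cite: BrockerTomDieck1985, Ch. IV (3.1)–(3.2)] -/
theorem isCompact_centralizer_of_isArchNormPair_archSingularCurve (hα : ∀ i, α i ≠ 0) (hherm : ∀ i, (IsCMField.complexConj L (α i) : L) = α i) (ψ : ℝ)
    (hinj : ∀ w : {w : InfinitePlace L // IsComplex w}, Function.Injective (fun i : Fin 3 => z₀ w i * Circle.exp (![(1 : ℝ), 0, -1] i * (c w * ψ))))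
    (γ' : ↥(UnitaryGroup.arch (↥(maximalRealSubfield L)) L (IsCMField.complexConj L) 3 (Matrix.diagonal α))) (hnp : IsArchNormPair L (Matrix.diagonal α) (γH ψ) γ') :
    IsCompact ((Subgroup.centralizer ({γ'} : Set ↥(UnitaryGroup.arch (↥(maximalRealSubfield L)) L (IsCMField.complexConj L) 3 (Matrix.diagonal α)))) :
      Set ↥(UnitaryGroup.arch (↥(maximalRealSubfield L)) L (IsCMField.complexConj L) 3 (Matrix.diagonal α))) := by
  have hnpG := isArchNormPair_archSingularCurve L α z₀ c γH γG hγH hγG ψ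
  rw [isArchNormPair_iff] at hnp hnpG
  -- `γG(ψ) ↔ γ′`: stable conjugacy of the torus point with the partner
  have hst : IsStablyConj (UnitaryGroup.conjMixed (↥(maximalRealSubfield L)) L (IsCMField.complexConj L)) (UnitaryGroup.archFormOf L 3 (Matrix.diagonal α))
      (UnitaryGroup.archDiagTorus L 3 α fun w i => z₀ w i * Circle.exp (![(1 : ℝ), 0, -1] i * (c w * ψ))) γ' := by
    have h := hnpG.symm.trans hnp
    rw [hγG] at h
    exact h
  obtain ⟨ρ, hρ⟩ := exists_isConj_archDiagTorus_of_isStablyConj_of_conj L 3 α hα hherm _ γ' hst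
  exact isCompact_centralizer_singleton_of_isConj hρ (isCompact_centralizer_archDiagTorus L 3 α hα fun w => (hinj w).comp (ρ w).injective)

include hγH hγG in
/-- The same as a `CompactSpace` instance term (the `hZ′` binder of ★ (E1) `finsum_integral_comp_conj_eq_finsum_delta_mul_integral_comp_conj_of_isArchDeltaTransfer`).
[cite: Rogawski1990, §14.3 p. 234] -/
theorem compactSpace_centralizer_of_isArchNormPair_archSingularCurve (hα : ∀ i, α i ≠ 0) (hherm : ∀ i, (IsCMField.complexConj L (α i) : L) = α i) (ψ : ℝ)
    (hinj : ∀ w : {w : InfinitePlace L // IsComplex w}, Function.Injective (fun i : Fin 3 => z₀ w i * Circle.exp (![(1 : ℝ), 0, -1] i * (c w * ψ))))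
    (γ' : ↥(UnitaryGroup.arch (↥(maximalRealSubfield L)) L (IsCMField.complexConj L) 3 (Matrix.diagonal α))) (hnp : IsArchNormPair L (Matrix.diagonal α) (γH ψ) γ') :
    CompactSpace (Subgroup.centralizer ({γ'} : Set ↥(UnitaryGroup.arch (↥(maximalRealSubfield L)) L (IsCMField.complexConj L) 3 (Matrix.diagonal α)))) :=
  isCompact_iff_compactSpace.1 (isCompact_centralizer_of_isArchNormPair_archSingularCurve L α z₀ c γH γG hγH hγG hα hherm ψ hinj γ' hnp)

end Curve

end Literature.NumberTheory.Rogawski1990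

end
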